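import Literature.Probability.RandomPlanarGeometry.HexSAWArmchairWallBridges
import HarnessLib

/-!
# Beaton's unfolding step along the ARMCHAIR surface: the half-integer mirror with inserted edges, its injectivity given the old
# maximum, and termination after `O(√n)` steps

Topic `Literature/Probability/RandomPlanarGeometry` (continues `HexSAWArmchairWallBridges.lean` — the armchair half-plane walks `hp n`,
arches, wall bridges `wb n`, `visits`, the mirrors `flipY`, `shiftY` — ; lane «pcv-sawmu», door «HEX-YC-ROT-LIMIT-ALL-Y», Part B1).
Sources: N. R. Beaton, *The critical surface fugacity of self-avoiding walks on a rotated honeycomb lattice*, J. Phys. A 47 (2014) 075003,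
arXiv:1210.0274v3, §3.1, proof of Proposition 7 (pp. 12–13: "The process of unfolding on our honeycomb lattice is made more complicated by
the fact that the lattice is not invariant under reflection through a vertical line passing through a vertex. It is thus necessary to insert
a horizontal edge into a walk each time we reflect a component"; the fixed-length unfolding, steps 1–6; "we never have to perform the
unfolding operation more than ⌊3√n⌋ times"); J. M. Hammersley, G. M. Torrie, S. G. Whittington, J. Phys. A 15 (1982) 539, §2 (unfolded
walks); N. Madras, G. Slade, *The Self-Avoiding Walk* (1993), §3.1, proof of Proposition 3.1.5 (the unfolding step, "A₁ > A₂ > ⋯",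
recovery of `ω` from `ω'` and `A₁`).

## What is proved (all statements PROVED, no hypotheses beyond membership in the lane's classes)

In the brick-wall chart of `HexSAWArmchairWallBridges.lean` (wall = column `X = 0`, level `Y` along the wall) one unfolding step
`ust : (n, ω) ↦ (n', ω')` on `C`-class walks: with `M = maxY`, `t = lastTop` (last time at level `M`), pivot `z = ω_t` (odd type, the walk
leaves it DOWN the dimer — `pivot_anatomy`), `p = ω_{t−1}` (horizontal neighbour), free side `q = 2z − p` (`free_side`: not on the walk):
* case A (`q` in the half-plane): `ω' = ω[0..t] ++ [q, q+e₁, z+e₁] ++ S_{2M+1}(ω[t+1..n])`, `n' = n + 3` (`uA`, `uA_mem`);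
* case B (`z = (0,M)` on the wall, `p = (1,M)`; `boxed_case`): `ω' = ω[0..t−1] ++ [(1,M+1)] ++ S_{2M+1}(ω[t..n])`, `n' = n + 1` (`uB`, `uB_mem`);
where `S_c(X,Y) = (X, c − Y)` is an automorphism for `c` odd (`adj_flipY_iff`).  Proved: `ust_spec` (stays in the `C`-class, endpoint
abscissa kept, visits `v ≤ v' ≤ v + 2`, strict bottom kept, new maximum `M + D` with the depth `D = M + 1 − tailMin ≥ 2`), `depth_ust`
(`D' ≤ D − 1` along an effective run), `ust_injOn_level` (the step is injective given `M`: decode by the last time at level `≤ M` and a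
column test), `iterate_spec`, and the termination `not_lt_iterate`: if `K(K−1) > 2n` the `K`-th iterate is top-unfolded.
LABEL: CONSOLIDATION (Beaton 2014 Prop. 7's fixed-length unfolding, made explicit and machine-checked in the brick-wall chart; the lane's
own device is the pair of connectors and the depth bookkeeping).
-/

noncomputable section

open Finset Filter Function
open Literature.Probability.LatticeModels Literature.Probability.Percolation SimpleGraph
open _root_.Topology

namespace Literature.Probability.RandomPlanarGeometry.SAW.HexBW.Arm

variable {y : ℝ} {n : ℕ} {ω : ℕ → Site 2}

/-! ### The maximal level along the wall and the last time it is attained -/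

/-- `M(ω)`: the maximum of `Y` over the times `0, …, n`. [cite: Beaton2014RotatedHoneycomb, §3.1 (arXiv v3 p. 13: "vertices … with maximal x-coordinate")] -/
def maxY (n : ℕ) (ω : ℕ → Site 2) : ℤ := (Finset.range (n + 1)).sup' ⟨0, by simp⟩ fun i => ω i 1

/-- Every level is at most the maximum. [cite: MadrasSlade1993, §3.1 (proof of Proposition 3.1.5: A₁(ω), n₁(ω), the unfolded walk ω')] -/
theorem le_maxY {n : ℕ} (ω : ℕ → Site 2) {i : ℕ} (hi : i ≤ n) : ω i 1 ≤ maxY n ω :=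
  Finset.le_sup' (fun i => ω i 1) (Finset.mem_range.2 (Nat.lt_succ_of_le hi))

/-- The maximum is attained. [cite: MadrasSlade1993, §3.1 (proof of Proposition 3.1.5: A₁(ω), n₁(ω), the unfolded walk ω')] -/
theorem exists_eq_maxY (n : ℕ) (ω : ℕ → Site 2) : ∃ i ≤ n, ω i 1 = maxY n ω := by
  obtain ⟨i, hi, h⟩ := Finset.exists_mem_eq_sup' (⟨0, by simp⟩ : (Finset.range (n + 1)).Nonempty) fun i => ω i 1
  exact ⟨i, Nat.le_of_lt_succ (Finset.mem_range.1 hi), h.symm⟩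

/-- A bound on all levels bounds the maximum. [cite: MadrasSlade1993, §3.1 (proof of Proposition 3.1.5: A₁(ω), n₁(ω), the unfolded walk ω')] -/
theorem maxY_le {n : ℕ} {ω : ℕ → Site 2} {M : ℤ} (h : ∀ i ≤ n, ω i 1 ≤ M) : maxY n ω ≤ M :=
  Finset.sup'_le _ _ fun i hi => h i (Nat.le_of_lt_succ (Finset.mem_range.1 hi))

/-- `t(ω)`: the LAST time at which the maximal level is attained ("let v₁ be the last of those vertices visited by γ").
[cite: Beaton2014RotatedHoneycomb, §3.1 (arXiv v3 p. 13, step 3 of the fixed-length unfolding)] -/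
def lastTop (n : ℕ) (ω : ℕ → Site 2) : ℕ := Nat.findGreatest (fun i => ω i 1 = maxY n ω) n

/-- `t ≤ n`. [cite: MadrasSlade1993, §3.1 (proof of Proposition 3.1.5: A₁(ω), n₁(ω), the unfolded walk ω')] -/
theorem lastTop_le (n : ℕ) (ω : ℕ → Site 2) : lastTop n ω ≤ n := Nat.findGreatest_le n

/-- The maximum is attained at `t`. [cite: MadrasSlade1993, §3.1 (proof of Proposition 3.1.5: A₁(ω), n₁(ω), the unfolded walk ω')] -/
theorem lastTop_spec (n : ℕ) (ω : ℕ → Site 2) : ω (lastTop n ω) 1 = maxY n ω := by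
  obtain ⟨i, hi, h⟩ := exists_eq_maxY n ω
  exact Nat.findGreatest_spec (P := fun i => ω i 1 = maxY n ω) hi h

/-- After `t` the level is strictly below the maximum. [cite: MadrasSlade1993, §3.1 (proof of Proposition 3.1.5: A₁(ω), n₁(ω), the unfolded walk ω')] -/
theorem lt_maxY_of_lastTop_lt {n : ℕ} (ω : ℕ → Site 2) {i : ℕ} (h1 : lastTop n ω < i) (h2 : i ≤ n) : ω i 1 < maxY n ω :=
  lt_of_le_of_ne (le_maxY ω h2) (Nat.findGreatest_is_greatest h1 h2)

/-- A time attaining a level that dominates everything and strictly dominates everything after it is `t`. [cite: MadrasSlade1993, §3.1 (proof of Proposition 3.1.5: A₁(ω), n₁(ω), the unfolded walk ω')] -/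
theorem lastTop_eq_of {n : ℕ} {ω : ℕ → Site 2} {p : ℕ} (hp : p ≤ n) (hmax : ∀ i ≤ n, ω i 1 ≤ ω p 1)
    (hlt : ∀ i, p < i → i ≤ n → ω i 1 < ω p 1) : lastTop n ω = p ∧ maxY n ω = ω p 1 := by
  have hM : maxY n ω = ω p 1 := le_antisymm (maxY_le hmax) (le_maxY ω hp)
  refine ⟨?_, hM⟩
  have h2 := lastTop_spec n ω
  rw [hM] at h2
  by_contra hne
  rcases lt_or_gt_of_ne hne with h | h
  · exact absurd hM.symm (lt_maxY_of_lastTop_lt ω h hp).ne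
  · exact absurd h2 (hlt _ h (lastTop_le n ω)).ne

/-- For a walk from `0`, `0 ≤ M ≤ n`. [cite: MadrasSlade1993, §3.1 (proof of Proposition 3.1.5: A₁(ω), n₁(ω), the unfolded walk ω')] -/
theorem maxY_bounds (hω : ω ∈ saws n) : 0 ≤ maxY n ω ∧ maxY n ω ≤ n := by
  obtain ⟨h0, -, -, -⟩ := mem_saws_iff.1 hω
  obtain ⟨-, -, hadj, -⟩ := Zd.mem_saws.1 (saws_subset _ hω)
  constructor
  · have := le_maxY (n := n) ω (Nat.zero_le n); rw [h0] at this; exact this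
  · refine maxY_le fun i hi => ?_
    have := (abs_le.1 (Zd.abs_apply_le_of_adj h0 hadj i hi 1)).2
    omega

/-! ### Anatomy of the pivot `z = ω_t` when `t < n` -/

section Pivot

variable (hω : ω ∈ hp n) (ht : lastTop n ω < n)
include hω ht

/-- The pivot is not the start: `1 ≤ t`. [cite: Beaton2014RotatedHoneycomb, §3.1, proof of Proposition 7 (arXiv v3 pp. 12–13)] -/
theorem one_le_lastTop : 1 ≤ lastTop n ω := by
  obtain ⟨hs, hH⟩ := mem_hp.1 hω
  obtain ⟨h0, -, hbw, -⟩ := mem_saws_iff.1 hs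
  by_contra h
  have ht0 : lastTop n ω = 0 := by omega
  have hM : maxY n ω = 0 := by rw [← lastTop_spec n ω, ht0, h0]; rfl
  have h1 := lt_maxY_of_lastTop_lt ω (show lastTop n ω < 1 by omega) (by omega)
  rw [hM] at h1
  have hX := hH 1 (by omega)
  have hstep := step_cases (hbw 0 (by omega))
  rw [show (0 : ℕ) + 1 = 1 from rfl, h0] at hstep
  have z0 : (0 : Site 2) 0 = 0 := rfl
  have z1 : (0 : Site 2) 1 = 0 := rfl
  rw [z0, z1] at hstep
  omega

/-- **Anatomy of the pivot** `z = ω_t` (`t < n`): writing `w = ω_{t+1}`, `p = ω_{t-1}`: `1 ≤ t`; the step out of `z` goes DOWN the dimer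
(`w = z − e₁`, `w` of even type); the step into `z` is HORIZONTAL (`Y_p = Y_z`, `|X_p − X_z| = 1`).
[cite: Beaton2014RotatedHoneycomb, §3.1 (arXiv v3 p. 13, step 3 of the fixed-length unfolding); EntingJensen2009, §7.4.2, Fig. 7.10] -/
theorem pivot_anatomy : 1 ≤ lastTop n ω ∧
    (ω (lastTop n ω + 1) 0 = ω (lastTop n ω) 0 ∧ ω (lastTop n ω) 1 = ω (lastTop n ω + 1) 1 + 1 ∧
      (ω (lastTop n ω + 1) 0 + ω (lastTop n ω + 1) 1) % 2 = 0) ∧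
    (ω (lastTop n ω - 1) 1 = ω (lastTop n ω) 1 ∧
      (ω (lastTop n ω) 0 = ω (lastTop n ω - 1) 0 + 1 ∨ ω (lastTop n ω - 1) 0 = ω (lastTop n ω) 0 + 1)) := by
  have h1t := one_le_lastTop hω ht
  obtain ⟨hs, -⟩ := mem_hp.1 hω
  obtain ⟨-, -, hbw, hinj⟩ := mem_saws_iff.1 hs
  have hM := lastTop_spec n ω
  have hw := lt_maxY_of_lastTop_lt ω (show lastTop n ω < lastTop n ω + 1 by omega) (by omega)
  have hp := le_maxY (n := n) ω (show lastTop n ω - 1 ≤ n by omega)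
  have hb1 := hbw (lastTop n ω) ht
  have hb0 := hbw (lastTop n ω - 1) (by omega)
  rw [show lastTop n ω - 1 + 1 = lastTop n ω by omega] at hb0
  generalize lastTop n ω = t at *
  have down : ω (t + 1) 0 = ω t 0 ∧ ω t 1 = ω (t + 1) 1 + 1 ∧ (ω (t + 1) 0 + ω (t + 1) 1) % 2 = 0 := by
    rcases step_cases hb1 with ⟨hy, -⟩ | ⟨-, hy, -⟩ | ⟨hx, hy, he⟩
    · omega
    · omega
    · exact ⟨hx, hy, he⟩
  refine ⟨h1t, down, ?_⟩
  obtain ⟨ax, ay, -⟩ := down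
  rcases step_cases hb0 with ⟨hy, hx⟩ | ⟨hx, hy, -⟩ | ⟨-, hy, -⟩
  · exact ⟨hy.symm, hx⟩
  · -- up into the pivot: then `ω_{t-1} = ω_{t+1}`, contradicting self-avoidance
    exfalso
    have heq : ω (t - 1) = ω (t + 1) := by rw [site_two_eq_iff]; constructor <;> omega
    have := hinj (show t - 1 ∈ {i | i ≤ n} by simp; omega) (show t + 1 ∈ {i | i ≤ n} by simp; omega) heq
    omega
  · omega

/-- **The free side of the pivot**: the horizontal neighbour `q = 2 ω_t − ω_{t−1}` of the pivot opposite to `ω_{t−1}` is not on the walk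
(when it lies in the half-plane). [cite: Beaton2014RotatedHoneycomb, §3.1 (arXiv v3 p. 12, the inserted horizontal edge)] -/
theorem free_side (hq : 0 ≤ 2 * ω (lastTop n ω) 0 - ω (lastTop n ω - 1) 0) {i : ℕ} (hi : i ≤ n) :
    ¬ (ω i 0 = 2 * ω (lastTop n ω) 0 - ω (lastTop n ω - 1) 0 ∧ ω i 1 = ω (lastTop n ω) 1) := by
  obtain ⟨hs, hH⟩ := mem_hp.1 hω
  obtain ⟨h0, -, hbw, hinj⟩ := mem_saws_iff.1 hs
  obtain ⟨h1t, ⟨ax, ay, ae⟩, ⟨py_, px⟩⟩ := pivot_anatomy hω ht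
  have hM := lastTop_spec n ω
  have hafter : ∀ j, lastTop n ω < j → j ≤ n → ω j 1 < maxY n ω := fun j h1 h2 => lt_maxY_of_lastTop_lt ω h1 h2
  have hall : ∀ j ≤ n, ω j 1 ≤ maxY n ω := fun j hj => le_maxY ω hj
  have hXt := hH (lastTop n ω) (by omega)
  have hXp := hH (lastTop n ω - 1) (by omega)
  generalize lastTop n ω = t at *
  rintro ⟨qi0, qi1⟩
  -- `i ≤ t` (level `M` is not visited after `t`), `i ≠ t`, `i ≠ t - 1`
  have hit : i ≤ t := by
    by_contra h
    have := hafter i (by omega) hi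
    omega
  have hne1 : i ≠ t := by rintro rfl; omega
  have hne2 : i ≠ t - 1 := by rintro rfl; omega
  have hit' : i + 1 < t := by omega
  -- the walk neighbours of `ω i` lie on the far side `2 ω_i − z`
  have key : ∀ j, j ≤ n → brickWallGraph.Adj (ω i) (ω j) → j ≠ t → ω j 0 = 2 * ω i 0 - ω t 0 ∧ ω j 1 = ω i 1 := by
    intro j hj hadj hjt
    have hjlev := hall j hj
    rcases step_cases hadj with ⟨hy, hx⟩ | ⟨hx, hy, he⟩ | ⟨hx, hy, he⟩
    · by_cases hX : ω j 0 = ω t 0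
      · exfalso
        have heq : ω j = ω t := by rw [site_two_eq_iff]; constructor <;> omega
        exact hjt (hinj (show j ∈ {i | i ≤ n} by exact hj) (show t ∈ {i | i ≤ n} by simp; omega) heq)
      · constructor <;> omega
    · omega
    · omega
  have hadj1 : brickWallGraph.Adj (ω i) (ω (i + 1)) := hbw i (by omega)
  obtain ⟨a0, a1⟩ := key (i + 1) (by omega) hadj1 (by omega)
  rcases Nat.eq_zero_or_pos i with rfl | hipos
  · -- `q = ω 0 = 0`: then `z = (1, 0)`, `p = (2, 0)`; but `ω 1 = (2·0 − 1, 0) = (−1, 0)` is outside the half-plane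
    rw [h0] at qi0 qi1 a0
    have z0 : (0 : Site 2) 0 = 0 := rfl
    have z1 : (0 : Site 2) 1 = 0 := rfl
    rw [z0] at qi0 a0; rw [z1] at qi1
    have := hH 1 (by omega)
    rw [show (0 : ℕ) + 1 = 1 from rfl] at a0
    omega
  · have hadj0 : brickWallGraph.Adj (ω i) (ω (i - 1)) := by
      have := hbw (i - 1) (by omega); rw [show i - 1 + 1 = i by omega] at this; exact this.symm
    obtain ⟨b0, b1⟩ := key (i - 1) (by omega) hadj0 (by omega)
    have heq : ω (i + 1) = ω (i - 1) := by rw [site_two_eq_iff]; constructor <;> omega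
    have := hinj (show i + 1 ∈ {i | i ≤ n} by simp; omega) (show i - 1 ∈ {i | i ≤ n} by simp; omega) heq
    omega

/-- In the boxed case (the free side is outside the half-plane) the pivot is ON the wall and entered from `(1, M)`; then `t ≥ 2`
and `ω_{t−2} = (2, M)`. [cite: Beaton2014RotatedHoneycomb, §3.1, proof of Proposition 7 (arXiv v3 pp. 12–13)] -/
theorem boxed_case (hq : 2 * ω (lastTop n ω) 0 - ω (lastTop n ω - 1) 0 < 0) :
    ω (lastTop n ω) 0 = 0 ∧ ω (lastTop n ω - 1) 0 = 1 ∧ 2 ≤ lastTop n ω ∧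
      ω (lastTop n ω - 2) 0 = 2 ∧ ω (lastTop n ω - 2) 1 = ω (lastTop n ω) 1 := by
  obtain ⟨hs, hH⟩ := mem_hp.1 hω
  obtain ⟨h0, -, hbw, hinj⟩ := mem_saws_iff.1 hs
  obtain ⟨h1t, ⟨ax, ay, ae⟩, ⟨py_, px⟩⟩ := pivot_anatomy hω ht
  have hall : ∀ j ≤ n, ω j 1 ≤ maxY n ω := fun j hj => le_maxY ω hj
  have hM := lastTop_spec n ω
  have hXt := hH (lastTop n ω) (by omega)
  have hXp := hH (lastTop n ω - 1) (by omega)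
  have hb : 2 ≤ lastTop n ω → brickWallGraph.Adj (ω (lastTop n ω - 2)) (ω (lastTop n ω - 1)) := fun h2 => by
    have := hbw (lastTop n ω - 2) (by omega); rwa [show lastTop n ω - 2 + 1 = lastTop n ω - 1 by omega] at this
  generalize lastTop n ω = t at *
  have hz0 : ω t 0 = 0 := by omega
  have hp0 : ω (t - 1) 0 = 1 := by omega
  have h2t : 2 ≤ t := by
    by_contra h
    have ht1 : t = 1 := by omega
    rw [ht1, Nat.sub_self, h0] at hp0
    exact absurd hp0 (by decide)
  refine ⟨hz0, hp0, h2t, ?_⟩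
  have hlev := hall (t - 2) (by omega)
  rcases step_cases (hb h2t) with ⟨hy, hx⟩ | ⟨hx, hy, he⟩ | ⟨hx, hy, he⟩
  · rcases hx with hx | hx
    · -- `ω (t-2) 0 = 0`, level `M`: `ω (t-2) = z`, contradiction
      exfalso
      have heq : ω (t - 2) = ω t := by rw [site_two_eq_iff]; constructor <;> omega
      have := hinj (show t - 2 ∈ {i | i ≤ n} by simp; omega) (show t ∈ {i | i ≤ n} by simp; omega) heq
      omega
    · constructor <;> omega
  · omega
  · omega

end Pivot


/-! ### The two splices: case A (free side inside) and case B (boxed at the wall) -/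

/-- The free side `q = 2 z − p` of the pivot. [cite: Beaton2014RotatedHoneycomb, §3.1, proof of Proposition 7 (arXiv v3 pp. 12–13)] -/
def qOf (n : ℕ) (ω : ℕ → Site 2) : Site 2 := fun j => 2 * ω (lastTop n ω) j - ω (lastTop n ω - 1) j

/-- Coordinates of `q`. [cite: Beaton2014RotatedHoneycomb, §3.1, proof of Proposition 7 (arXiv v3 pp. 12–13: the fixed-length unfolding)] -/
theorem qOf_apply_zero (n : ℕ) (ω : ℕ → Site 2) : qOf n ω 0 = 2 * ω (lastTop n ω) 0 - ω (lastTop n ω - 1) 0 := rfl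
/-- Coordinates of `q`. [cite: Beaton2014RotatedHoneycomb, §3.1, proof of Proposition 7 (arXiv v3 pp. 12–13: the fixed-length unfolding)] -/
theorem qOf_apply_one (n : ℕ) (ω : ℕ → Site 2) : qOf n ω 1 = 2 * ω (lastTop n ω) 1 - ω (lastTop n ω - 1) 1 := rfl

/-- **Case A of the unfolding step** (free side `q` inside the half-plane): keep `ω` up to the pivot `z = ω_t`, insert `q`, `q + e₁`, `z + e₁`,
then the rest of the walk reflected in the half-integer mirror `Y = M + ½` (three inserted vertices).
[cite: Beaton2014RotatedHoneycomb, §3.1 (arXiv v3 p. 12: "insert a horizontal edge … each time we reflect a component")] -/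
def uA (n : ℕ) (ω : ℕ → Site 2) : ℕ → Site 2 := fun i =>
  if i ≤ lastTop n ω then ω i
  else if i = lastTop n ω + 1 then qOf n ω
  else if i = lastTop n ω + 2 then shiftY 1 (qOf n ω)
  else if i = lastTop n ω + 3 then shiftY 1 (ω (lastTop n ω))
  else flipY (2 * maxY n ω + 1) (ω (i - 3))

/-- **Case B of the unfolding step** (pivot on the wall, boxed by `p = (1, M)`): keep `ω` up to `p`, insert `p + e₁ = (1, M+1)`, then the
walk from the pivot on reflected in `Y = M + ½` (one inserted vertex). [cite: Beaton2014RotatedHoneycomb, §3.1 (arXiv v3 pp. 12–13)] -/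
def uB (n : ℕ) (ω : ℕ → Site 2) : ℕ → Site 2 := fun i =>
  if i < lastTop n ω then ω i
  else if i = lastTop n ω then shiftY 1 (ω (lastTop n ω - 1))
  else flipY (2 * maxY n ω + 1) (ω (i - 1))

section Values

variable (n : ℕ) (ω : ℕ → Site 2)

/-- Values of `uA` on the head. [cite: Beaton2014RotatedHoneycomb, §3.1, proof of Proposition 7 (arXiv v3 pp. 12–13: the fixed-length unfolding)] -/
theorem uA_of_le {i : ℕ} (hi : i ≤ lastTop n ω) : uA n ω i = ω i := by unfold uA; rw [if_pos hi]
/-- Value of `uA` at `t+1`. [cite: Beaton2014RotatedHoneycomb, §3.1, proof of Proposition 7 (arXiv v3 pp. 12–13: the fixed-length unfolding)] -/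
theorem uA_t1 : uA n ω (lastTop n ω + 1) = qOf n ω := by unfold uA; rw [if_neg (by omega), if_pos rfl]
/-- Value of `uA` at `t+2`. [cite: Beaton2014RotatedHoneycomb, §3.1, proof of Proposition 7 (arXiv v3 pp. 12–13: the fixed-length unfolding)] -/
theorem uA_t2 : uA n ω (lastTop n ω + 2) = shiftY 1 (qOf n ω) := by
  unfold uA; rw [if_neg (by omega), if_neg (by omega), if_pos rfl]
/-- Value of `uA` at `t+3`. [cite: Beaton2014RotatedHoneycomb, §3.1, proof of Proposition 7 (arXiv v3 pp. 12–13: the fixed-length unfolding)] -/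
theorem uA_t3 : uA n ω (lastTop n ω + 3) = shiftY 1 (ω (lastTop n ω)) := by
  unfold uA; rw [if_neg (by omega), if_neg (by omega), if_neg (by omega), if_pos rfl]
/-- Values of `uA` on the reflected tail. [cite: Beaton2014RotatedHoneycomb, §3.1, proof of Proposition 7 (arXiv v3 pp. 12–13: the fixed-length unfolding)] -/
theorem uA_of_ge {i : ℕ} (hi : lastTop n ω + 4 ≤ i) : uA n ω i = flipY (2 * maxY n ω + 1) (ω (i - 3)) := by
  unfold uA; rw [if_neg (by omega), if_neg (by omega), if_neg (by omega), if_neg (by omega)]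
/-- Values of `uB` on the head. [cite: Beaton2014RotatedHoneycomb, §3.1, proof of Proposition 7 (arXiv v3 pp. 12–13: the fixed-length unfolding)] -/
theorem uB_of_lt {i : ℕ} (hi : i < lastTop n ω) : uB n ω i = ω i := by unfold uB; rw [if_pos hi]
/-- Value of `uB` at `t`. [cite: Beaton2014RotatedHoneycomb, §3.1, proof of Proposition 7 (arXiv v3 pp. 12–13: the fixed-length unfolding)] -/
theorem uB_t : uB n ω (lastTop n ω) = shiftY 1 (ω (lastTop n ω - 1)) := by unfold uB; rw [if_neg (lt_irrefl _), if_pos rfl]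
/-- Values of `uB` on the reflected part. [cite: Beaton2014RotatedHoneycomb, §3.1, proof of Proposition 7 (arXiv v3 pp. 12–13: the fixed-length unfolding)] -/
theorem uB_of_gt {i : ℕ} (hi : lastTop n ω < i) : uB n ω i = flipY (2 * maxY n ω + 1) (ω (i - 1)) := by
  unfold uB; rw [if_neg (by omega), if_neg (by omega)]

end Values

section StepA

variable (hω : ω ∈ hp n) (ht : lastTop n ω < n) (hq : 0 ≤ qOf n ω 0)
include hω ht hq

omit hq in
/-- **The level profile of `uA`**: head `≤ M` (time `≤ t`), `q` at level `M`, two vertices at `M+1`, reflected tail `≥ M+2`. [cite: Beaton2014RotatedHoneycomb, §3.1, proof of Proposition 7 (arXiv v3 pp. 12–13: the fixed-length unfolding)] -/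
theorem uA_profile {i : ℕ} (hi : i ≤ n + 3) :
    (i ≤ lastTop n ω ∧ uA n ω i = ω i ∧ ω i 1 ≤ maxY n ω) ∨
    (i = lastTop n ω + 1 ∧ uA n ω i 0 = qOf n ω 0 ∧ uA n ω i 1 = maxY n ω) ∨
    (i = lastTop n ω + 2 ∧ uA n ω i 0 = qOf n ω 0 ∧ uA n ω i 1 = maxY n ω + 1) ∨
    (i = lastTop n ω + 3 ∧ uA n ω i 0 = ω (lastTop n ω) 0 ∧ uA n ω i 1 = maxY n ω + 1) ∨
    (lastTop n ω + 4 ≤ i ∧ uA n ω i 0 = ω (i - 3) 0 ∧ uA n ω i 1 = 2 * maxY n ω + 1 - ω (i - 3) 1 ∧ ω (i - 3) 1 ≤ maxY n ω - 1) := by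
  obtain ⟨h1t, ⟨ax, ay, ae⟩, ⟨py_, px⟩⟩ := pivot_anatomy hω ht
  have hM := lastTop_spec n ω
  rcases Nat.lt_or_ge i (lastTop n ω + 1) with h1 | h1
  · exact Or.inl ⟨by omega, uA_of_le n ω (by omega), le_maxY ω (by omega)⟩
  rcases Nat.lt_or_ge i (lastTop n ω + 4) with h4 | h4
  · have hc : i = lastTop n ω + 1 ∨ i = lastTop n ω + 2 ∨ i = lastTop n ω + 3 := by omega
    rcases hc with rfl | rfl | rfl
    · right; left; refine ⟨rfl, by rw [uA_t1], ?_⟩; rw [uA_t1, qOf_apply_one, py_, hM]; ring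
    · right; right; left; refine ⟨rfl, by rw [uA_t2, shiftY_apply_zero], ?_⟩
      rw [uA_t2, shiftY_apply_one, qOf_apply_one, py_, hM]; ring
    · right; right; right; left; exact ⟨rfl, by rw [uA_t3, shiftY_apply_zero], by rw [uA_t3, shiftY_apply_one, hM]⟩
  · right; right; right; right
    have hlt := lt_maxY_of_lastTop_lt ω (show lastTop n ω < i - 3 by omega) (by omega)
    exact ⟨h4, by rw [uA_of_ge n ω h4, flipY_apply_zero], by rw [uA_of_ge n ω h4, flipY_apply_one], by omega⟩

/-- **`uA` is a half-plane walk from the wall** (`n + 3` steps). [cite: Beaton2014RotatedHoneycomb, §3.1, proof of Proposition 7 (arXiv v3 pp. 12–13)] -/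
theorem uA_mem : uA n ω ∈ hp (n + 3) := by
  obtain ⟨hs, hH⟩ := mem_hp.1 hω
  obtain ⟨h0, hfr, hbw, hinj⟩ := mem_saws_iff.1 hs
  obtain ⟨h1t, ⟨ax, ay, ae⟩, ⟨py_, px⟩⟩ := pivot_anatomy hω ht
  have hM := lastTop_spec n ω
  have hM0 := (maxY_bounds hs).1
  have hqfree := fun i (hi : i ≤ n) => free_side hω ht hq (i := i) hi
  have hq0 : qOf n ω 0 = 2 * ω (lastTop n ω) 0 - ω (lastTop n ω - 1) 0 := rfl
  have hq1 : qOf n ω 1 = ω (lastTop n ω) 1 := by rw [qOf_apply_one, py_]; ring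
  have hXt := hH (lastTop n ω) (by omega)
  have hXp := hH (lastTop n ω - 1) (by omega)
  have hodd : (2 * maxY n ω + 1) % 2 = 1 := by omega
  refine mem_hp.2 ⟨mem_saws_iff.2 ⟨?_, fun i hi => ?_, fun i hi => ?_, ?_⟩, fun i hi => ?_⟩
  · rw [uA_of_le n ω (Nat.zero_le _), h0]
  · rw [uA_of_ge n ω (by omega), uA_of_ge n ω (by omega), hfr (i - 3) (by omega), show n + 3 - 3 = n by omega]
  · -- brick-wall steps
    rcases Nat.lt_or_ge i (lastTop n ω) with h1 | h1
    · rw [uA_of_le n ω h1.le, uA_of_le n ω (by omega)]; exact hbw i (by omega)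
    rcases Nat.lt_or_ge i (lastTop n ω + 4) with h4 | h4
    · have hc : i = lastTop n ω ∨ i = lastTop n ω + 1 ∨ i = lastTop n ω + 2 ∨ i = lastTop n ω + 3 := by omega
      rcases hc with rfl | rfl | rfl | rfl
      · rw [uA_of_le n ω le_rfl, uA_t1]
        exact adj_of_horiz (by rw [hq1]) (by rw [hq0]; omega)
      · rw [uA_t1, show lastTop n ω + 1 + 1 = lastTop n ω + 2 by omega, uA_t2]
        refine adj_of_up (by rw [shiftY_apply_zero]) (by rw [shiftY_apply_one]) ?_
        rw [hq0, hq1]; omega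
      · rw [uA_t2, show lastTop n ω + 2 + 1 = lastTop n ω + 3 by omega, uA_t3]
        exact adj_of_horiz (by rw [shiftY_apply_one, shiftY_apply_one, hq1])
          (by rw [shiftY_apply_zero, shiftY_apply_zero, hq0]; omega)
      · rw [uA_t3, show lastTop n ω + 3 + 1 = lastTop n ω + 4 by omega, uA_of_ge n ω le_rfl,
          show lastTop n ω + 4 - 3 = lastTop n ω + 1 by omega]
        refine adj_of_up (by rw [shiftY_apply_zero, flipY_apply_zero, ax]) ?_ ?_
        · rw [shiftY_apply_one, flipY_apply_one, hM]; omega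
        · rw [shiftY_apply_zero, shiftY_apply_one]; omega
    · rw [uA_of_ge n ω h4, uA_of_ge n ω (by omega), show i + 1 - 3 = i - 3 + 1 by omega, adj_flipY_iff hodd]
      exact hbw (i - 3) (by omega)
  · -- injectivity on `[0, n+3]`
    intro i hi j hj hij
    simp only [Set.mem_setOf_eq] at hi hj
    have e0 := congrFun hij 0
    have e1 := congrFun hij 1
    rcases uA_profile hω ht hi with ⟨ai, av, al⟩ | ⟨ai, a0, a1⟩ | ⟨ai, a0, a1⟩ | ⟨ai, a0, a1⟩ | ⟨ai, a0, a1, al⟩ <;>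
      rcases uA_profile hω ht hj with ⟨bi, bv, bl⟩ | ⟨bi, b0, b1⟩ | ⟨bi, b0, b1⟩ | ⟨bi, b0, b1⟩ | ⟨bi, b0, b1, bl⟩
    -- head/head
    · rw [av, bv] at hij; exact hinj (show i ∈ {i | i ≤ n} by simp; omega) (show j ∈ {i | i ≤ n} by simp; omega) hij
    · -- head vs q
      exfalso; rw [av] at e0 e1; rw [b0] at e0; rw [b1] at e1
      exact hqfree i (by omega) ⟨by rw [e0, hq0], by rw [e1, hM]⟩
    · exfalso; rw [av] at e1; rw [b1] at e1; omega
    · exfalso; rw [av] at e1; rw [b1] at e1; omega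
    · exfalso; rw [av] at e1; rw [b1] at e1; omega
    · exfalso; rw [bv] at e0 e1; rw [a0] at e0; rw [a1] at e1
      exact hqfree j (by omega) ⟨by rw [← e0, hq0], by rw [← e1, hM]⟩
    · omega
    · exfalso; rw [a1, b1] at e1; omega
    · exfalso; rw [a1, b1] at e1; omega
    · exfalso; rw [a1, b1] at e1; omega
    · exfalso; rw [bv] at e1; rw [a1] at e1; omega
    · exfalso; rw [a1, b1] at e1; omega
    · omega
    · exfalso; rw [a0, b0] at e0; rw [hq0] at e0; omega
    · exfalso; rw [a1, b1] at e1; omega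
    · exfalso; rw [bv] at e1; rw [a1] at e1; omega
    · exfalso; rw [a1, b1] at e1; omega
    · exfalso; rw [a0, b0] at e0; rw [hq0] at e0; omega
    · omega
    · exfalso; rw [a1, b1] at e1; omega
    · exfalso; rw [bv] at e1; rw [a1] at e1; omega
    · exfalso; rw [a1, b1] at e1; omega
    · exfalso; rw [a1, b1] at e1; omega
    · exfalso; rw [a1, b1] at e1; omega
    · -- tail/tail
      have heq : ω (i - 3) = ω (j - 3) := by
        rw [site_two_eq_iff]; rw [a0, b0] at e0; rw [a1, b1] at e1; constructor <;> omega
      have := hinj (show i - 3 ∈ {i | i ≤ n} by simp; omega) (show j - 3 ∈ {i | i ≤ n} by simp; omega) heq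
      omega
  · -- half-plane
    rcases uA_profile hω ht hi with ⟨ai, av, -⟩ | ⟨-, a0, -⟩ | ⟨-, a0, -⟩ | ⟨-, a0, -⟩ | ⟨ai, a0, -, -⟩
    · rw [av]; exact hH i (by omega)
    · rw [a0]; exact hq
    · rw [a0]; exact hq
    · rw [a0]; exact hXt
    · rw [a0]; exact hH (i - 3) (by omega)

omit hω hq in
/-- The endpoint keeps its wall coordinate: `uA_{n+3} 0 = ω_n 0`. [cite: Beaton2014RotatedHoneycomb, §3.1, proof of Proposition 7 (arXiv v3 pp. 12–13: the fixed-length unfolding)] -/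
theorem uA_end_zero : uA n ω (n + 3) 0 = ω n 0 := by
  rw [uA_of_ge n ω (by omega), flipY_apply_zero, show n + 3 - 3 = n by omega]

omit hq in
/-- `uA` keeps a strict bottom. [cite: Beaton2014RotatedHoneycomb, §3.1, proof of Proposition 7 (arXiv v3 pp. 12–13: the fixed-length unfolding)] -/
theorem uA_bottom (hb : ∀ i, 1 ≤ i → i ≤ n → 1 ≤ ω i 1) {i : ℕ} (hi1 : 1 ≤ i) (hi : i ≤ n + 3) : 1 ≤ uA n ω i 1 := by
  have hM0 := (maxY_bounds (mem_hp.1 hω).1).1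
  have h1t := (pivot_anatomy hω ht).1
  have h1 : 1 ≤ ω (lastTop n ω) 1 := hb _ h1t ht.le
  have hM := lastTop_spec n ω
  rcases uA_profile hω ht hi with ⟨ai, av, -⟩ | ⟨-, -, a1⟩ | ⟨-, -, a1⟩ | ⟨-, -, a1⟩ | ⟨ai, -, a1, al⟩
  · rw [av]; exact hb i hi1 (by omega)
  · rw [a1]; omega
  · rw [a1]; omega
  · rw [a1]; omega
  · rw [a1]; omega

end StepA

section StepB

variable (hω : ω ∈ hp n) (ht : lastTop n ω < n) (hq : qOf n ω 0 < 0)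
include hω ht hq

/-- **The level profile of `uB`**: head `≤ M` (time `< t`), `(1, M+1)` at time `t`, `(0, M+1)` at time `t+1`, then `≥ M+2`. [cite: Beaton2014RotatedHoneycomb, §3.1, proof of Proposition 7 (arXiv v3 pp. 12–13: the fixed-length unfolding)] -/
theorem uB_profile {i : ℕ} (hi : i ≤ n + 1) :
    (i < lastTop n ω ∧ uB n ω i = ω i ∧ ω i 1 ≤ maxY n ω) ∨
    (i = lastTop n ω ∧ uB n ω i 0 = 1 ∧ uB n ω i 1 = maxY n ω + 1) ∨
    (i = lastTop n ω + 1 ∧ uB n ω i 0 = 0 ∧ uB n ω i 1 = maxY n ω + 1) ∨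
    (lastTop n ω + 2 ≤ i ∧ uB n ω i 0 = ω (i - 1) 0 ∧ uB n ω i 1 = 2 * maxY n ω + 1 - ω (i - 1) 1 ∧ ω (i - 1) 1 ≤ maxY n ω - 1) := by
  obtain ⟨h1t, ⟨ax, ay, ae⟩, ⟨py_, px⟩⟩ := pivot_anatomy hω ht
  obtain ⟨hz0, hp0, h2t, -, -⟩ := boxed_case hω ht hq
  have hM := lastTop_spec n ω
  rcases Nat.lt_or_ge i (lastTop n ω) with h1 | h1
  · exact Or.inl ⟨h1, uB_of_lt n ω h1, le_maxY ω (by omega)⟩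
  rcases Nat.lt_or_ge i (lastTop n ω + 2) with h4 | h4
  · have hc : i = lastTop n ω ∨ i = lastTop n ω + 1 := by omega
    rcases hc with rfl | rfl
    · right; left; exact ⟨rfl, by rw [uB_t, shiftY_apply_zero, hp0], by rw [uB_t, shiftY_apply_one, py_, hM]⟩
    · right; right; left
      refine ⟨rfl, by rw [uB_of_gt n ω (by omega), flipY_apply_zero, Nat.add_sub_cancel, hz0], ?_⟩
      rw [uB_of_gt n ω (by omega), flipY_apply_one, Nat.add_sub_cancel, hM]; ring
  · right; right; right
    have hlt := lt_maxY_of_lastTop_lt ω (show lastTop n ω < i - 1 by omega) (by omega)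
    exact ⟨h4, by rw [uB_of_gt n ω (by omega), flipY_apply_zero], by rw [uB_of_gt n ω (by omega), flipY_apply_one], by omega⟩

/-- **`uB` is a half-plane walk from the wall** (`n + 1` steps). [cite: Beaton2014RotatedHoneycomb, §3.1, proof of Proposition 7 (arXiv v3 pp. 12–13)] -/
theorem uB_mem : uB n ω ∈ hp (n + 1) := by
  obtain ⟨hs, hH⟩ := mem_hp.1 hω
  obtain ⟨h0, hfr, hbw, hinj⟩ := mem_saws_iff.1 hs
  obtain ⟨h1t, ⟨ax, ay, ae⟩, ⟨py_, px⟩⟩ := pivot_anatomy hω ht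
  obtain ⟨hz0, hp0, h2t, -, -⟩ := boxed_case hω ht hq
  have hM := lastTop_spec n ω
  have hM0 := (maxY_bounds hs).1
  have hodd : (2 * maxY n ω + 1) % 2 = 1 := by omega
  refine mem_hp.2 ⟨mem_saws_iff.2 ⟨?_, fun i hi => ?_, fun i hi => ?_, ?_⟩, fun i hi => ?_⟩
  · rw [uB_of_lt n ω (by omega), h0]
  · rw [uB_of_gt n ω (by omega), uB_of_gt n ω (by omega), hfr (i - 1) (by omega), show n + 1 - 1 = n by omega]
  · rcases Nat.lt_or_ge (i + 1) (lastTop n ω) with h1 | h1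
    · rw [uB_of_lt n ω (by omega), uB_of_lt n ω h1]; exact hbw i (by omega)
    rcases Nat.lt_or_ge i (lastTop n ω + 1) with h4 | h4
    · have hc : i + 1 = lastTop n ω ∨ i = lastTop n ω := by omega
      rcases hc with hc | rfl
      · have hi' : i = lastTop n ω - 1 := by omega
        rw [uB_of_lt n ω (by omega), hc, uB_t, ← hi']
        refine adj_of_up (by rw [shiftY_apply_zero]) (by rw [shiftY_apply_one]) ?_
        rw [hi', hp0, py_]; omega
      · rw [uB_t, uB_of_gt n ω (by omega), Nat.add_sub_cancel]
        refine adj_of_horiz ?_ (Or.inr ?_)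
        · rw [shiftY_apply_one, flipY_apply_one, py_, hM]; ring
        · rw [shiftY_apply_zero, flipY_apply_zero, hp0, hz0]; norm_num
    · rw [uB_of_gt n ω (by omega), uB_of_gt n ω (by omega), show i + 1 - 1 = i - 1 + 1 by omega, adj_flipY_iff hodd]
      exact hbw (i - 1) (by omega)
  · intro i hi j hj hij
    simp only [Set.mem_setOf_eq] at hi hj
    have e0 := congrFun hij 0
    have e1 := congrFun hij 1
    rcases uB_profile hω ht hq hi with ⟨ai, av, al⟩ | ⟨ai, a0, a1⟩ | ⟨ai, a0, a1⟩ | ⟨ai, a0, a1, al⟩ <;>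
      rcases uB_profile hω ht hq hj with ⟨bi, bv, bl⟩ | ⟨bi, b0, b1⟩ | ⟨bi, b0, b1⟩ | ⟨bi, b0, b1, bl⟩
    · rw [av, bv] at hij; exact hinj (show i ∈ {i | i ≤ n} by simp; omega) (show j ∈ {i | i ≤ n} by simp; omega) hij
    · exfalso; rw [av] at e1; rw [b1] at e1; omega
    · exfalso; rw [av] at e1; rw [b1] at e1; omega
    · exfalso; rw [av] at e1; rw [b1] at e1; omega
    · exfalso; rw [bv] at e1; rw [a1] at e1; omega
    · omega
    · exfalso; rw [a0, b0] at e0; omega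
    · exfalso; rw [a1, b1] at e1; omega
    · exfalso; rw [bv] at e1; rw [a1] at e1; omega
    · exfalso; rw [a0, b0] at e0; omega
    · omega
    · exfalso; rw [a1, b1] at e1; omega
    · exfalso; rw [bv] at e1; rw [a1] at e1; omega
    · exfalso; rw [a1, b1] at e1; omega
    · exfalso; rw [a1, b1] at e1; omega
    · have heq : ω (i - 1) = ω (j - 1) := by
        rw [site_two_eq_iff]; rw [a0, b0] at e0; rw [a1, b1] at e1; constructor <;> omega
      have := hinj (show i - 1 ∈ {i | i ≤ n} by simp; omega) (show j - 1 ∈ {i | i ≤ n} by simp; omega) heq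
      omega
  · rcases uB_profile hω ht hq hi with ⟨ai, av, -⟩ | ⟨-, a0, -⟩ | ⟨-, a0, -⟩ | ⟨ai, a0, -, -⟩
    · rw [av]; exact hH i (by omega)
    · rw [a0]; norm_num
    · rw [a0]
    · rw [a0]; exact hH (i - 1) (by omega)

omit hω hq in
/-- The endpoint keeps its wall coordinate: `uB_{n+1} 0 = ω_n 0`. [cite: Beaton2014RotatedHoneycomb, §3.1, proof of Proposition 7 (arXiv v3 pp. 12–13: the fixed-length unfolding)] -/
theorem uB_end_zero : uB n ω (n + 1) 0 = ω n 0 := by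
  rw [uB_of_gt n ω (by omega), flipY_apply_zero, Nat.add_sub_cancel]

/-- `uB` keeps a strict bottom. [cite: Beaton2014RotatedHoneycomb, §3.1, proof of Proposition 7 (arXiv v3 pp. 12–13: the fixed-length unfolding)] -/
theorem uB_bottom (hb : ∀ i, 1 ≤ i → i ≤ n → 1 ≤ ω i 1) {i : ℕ} (hi1 : 1 ≤ i) (hi : i ≤ n + 1) : 1 ≤ uB n ω i 1 := by
  have hM0 := (maxY_bounds (mem_hp.1 hω).1).1
  have h1t := (pivot_anatomy hω ht).1
  have h1 : 1 ≤ ω (lastTop n ω) 1 := hb _ h1t ht.le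
  have hM := lastTop_spec n ω
  rcases uB_profile hω ht hq hi with ⟨ai, av, -⟩ | ⟨-, -, a1⟩ | ⟨-, -, a1⟩ | ⟨ai, -, a1, al⟩
  · rw [av]; exact hb i hi1 (by omega)
  · rw [a1]; omega
  · rw [a1]; omega
  · rw [a1]; omega

end StepB


/-! ### The minimum of the tail and the new maximum `M' = 2M + 1 − m` -/

/-- `m(ω)`: the minimal level after the pivot (junk `0` if the walk is already unfolded).
[cite: MadrasSlade1993, §3.1 (proof of Proposition 3.1.5: the increments A_{k+1} − A_k)] -/
def tailMin (n : ℕ) (ω : ℕ → Site 2) : ℤ :=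
  if h : lastTop n ω < n then (Finset.Ioc (lastTop n ω) n).inf' (Finset.nonempty_Ioc.2 h) (fun i => ω i 1) else 0

/-- The last time the tail minimum is attained. [cite: MadrasSlade1993, §3.1 (proof of Proposition 3.1.5: A₁(ω), n₁(ω), the unfolded walk ω')] -/
def lastTM (n : ℕ) (ω : ℕ → Site 2) : ℕ := Nat.findGreatest (fun i => ω i 1 = tailMin n ω) n

section Tail

variable (ht : lastTop n ω < n)
include ht

/-- `m ≤ Y_i` on the tail. [cite: MadrasSlade1993, §3.1 (proof of Proposition 3.1.5: A₁(ω), n₁(ω), the unfolded walk ω')] -/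
theorem tailMin_le {i : ℕ} (h1 : lastTop n ω < i) (h2 : i ≤ n) : tailMin n ω ≤ ω i 1 := by
  rw [tailMin, dif_pos ht]
  exact Finset.inf'_le (fun i => ω i 1) (Finset.mem_Ioc.2 ⟨h1, h2⟩)

/-- The tail minimum is attained on the tail. [cite: MadrasSlade1993, §3.1 (proof of Proposition 3.1.5: A₁(ω), n₁(ω), the unfolded walk ω')] -/
theorem exists_eq_tailMin : ∃ s, lastTop n ω < s ∧ s ≤ n ∧ ω s 1 = tailMin n ω := by
  rw [tailMin, dif_pos ht]
  obtain ⟨s, hs, h⟩ := Finset.exists_mem_eq_inf' (Finset.nonempty_Ioc.2 ht) (fun i => ω i 1)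
  exact ⟨s, (Finset.mem_Ioc.1 hs).1, (Finset.mem_Ioc.1 hs).2, h.symm⟩

/-- `lastTM` is on the tail and attains the minimum. [cite: MadrasSlade1993, §3.1 (proof of Proposition 3.1.5: A₁(ω), n₁(ω), the unfolded walk ω')] -/
theorem lastTM_spec : lastTop n ω < lastTM n ω ∧ lastTM n ω ≤ n ∧ ω (lastTM n ω) 1 = tailMin n ω := by
  obtain ⟨s, h1, h2, h3⟩ := exists_eq_tailMin ht
  have hP : ω (lastTM n ω) 1 = tailMin n ω := Nat.findGreatest_spec (P := fun i => ω i 1 = tailMin n ω) h2 h3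
  have hle : lastTM n ω ≤ n := Nat.findGreatest_le n
  have hge : s ≤ lastTM n ω := Nat.le_findGreatest h2 h3
  exact ⟨by omega, hle, hP⟩

/-- After `lastTM` the level is strictly above the tail minimum. [cite: MadrasSlade1993, §3.1 (proof of Proposition 3.1.5: A₁(ω), n₁(ω), the unfolded walk ω')] -/
theorem tailMin_lt_of_lastTM_lt {i : ℕ} (h1 : lastTM n ω < i) (h2 : i ≤ n) : tailMin n ω < ω i 1 :=
  lt_of_le_of_ne (tailMin_le ht (lt_trans (lastTM_spec ht).1 h1) h2)
    (fun h => Nat.findGreatest_is_greatest h1 h2 h.symm)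

/-- `m ≤ M − 1` (the step out of the pivot goes down), for walks of the `C`-class. [cite: MadrasSlade1993, §3.1 (proof of Proposition 3.1.5: A₁(ω), n₁(ω), the unfolded walk ω')] -/
theorem tailMin_le_maxY_sub_one (hω : ω ∈ hp n) : tailMin n ω ≤ maxY n ω - 1 := by
  obtain ⟨-, ⟨-, ay, -⟩, -⟩ := pivot_anatomy hω ht
  have := tailMin_le ht (show lastTop n ω < lastTop n ω + 1 by omega) (by omega)
  rw [lastTop_spec n ω] at ay
  omega

end Tail

/-- **The depth of the fold**: `D(ω) = M + 1 − m`, the increment of the maximum produced by the unfolding step.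
[cite: MadrasSlade1993, §3.1 (proof of Proposition 3.1.5: "A₁ > A₂ > ⋯")] -/
def depth (n : ℕ) (ω : ℕ → Site 2) : ℤ := maxY n ω + 1 - tailMin n ω

section MaxA

variable (hω : ω ∈ hp n) (ht : lastTop n ω < n)
include hω ht

/-- **New maximum, case A**: `t(uA) = lastTM + 3` and `M(uA) = 2M + 1 − m`. [cite: MadrasSlade1993, §3.1 (proof of Proposition 3.1.5)] -/
theorem lastTop_uA : lastTop (n + 3) (uA n ω) = lastTM n ω + 3 ∧ maxY (n + 3) (uA n ω) = 2 * maxY n ω + 1 - tailMin n ω := by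
  obtain ⟨h1, h2, h3⟩ := lastTM_spec ht
  have hmM := tailMin_le_maxY_sub_one ht hω
  have hval : uA n ω (lastTM n ω + 3) 1 = 2 * maxY n ω + 1 - tailMin n ω := by
    rw [uA_of_ge n ω (by omega), flipY_apply_one, show lastTM n ω + 3 - 3 = lastTM n ω by omega, h3]
  have key := lastTop_eq_of (n := n + 3) (ω := uA n ω) (p := lastTM n ω + 3) (by omega) ?_ ?_
  · rw [hval] at key; exact key
  · intro i hi
    rw [hval]
    rcases uA_profile hω ht hi with ⟨-, av, al⟩ | ⟨-, -, a1⟩ | ⟨-, -, a1⟩ | ⟨-, -, a1⟩ | ⟨ai, -, a1, -⟩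
    · rw [av]; omega
    · rw [a1]; omega
    · rw [a1]; omega
    · rw [a1]; omega
    · rw [a1]; have := tailMin_le ht (show lastTop n ω < i - 3 by omega) (by omega); omega
  · intro i hpi hi
    rw [hval, uA_of_ge n ω (by omega), flipY_apply_one]
    have := tailMin_lt_of_lastTM_lt ht (show lastTM n ω < i - 3 by omega) (by omega)
    omega

/-- The increment of the maximum in case A is the depth: `M(uA) = M + D`. [cite: MadrasSlade1993, §3.1 (proof of Proposition 3.1.5)] -/
theorem maxY_uA : maxY (n + 3) (uA n ω) = maxY n ω + depth n ω := by
  rw [(lastTop_uA hω ht).2, depth]; ring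

/-- **Case A shrinks the depth**: if `uA` is not yet unfolded, `D(uA) ≤ D(ω) − 1` (its tail lies in the reflected old tail, at levels `≥ M + 2`).
[cite: MadrasSlade1993, §3.1 (proof of Proposition 3.1.5: "A₁ > A₂ > ⋯ > A_k")] -/
theorem depth_uA (ht' : lastTop (n + 3) (uA n ω) < n + 3) : depth (n + 3) (uA n ω) ≤ depth n ω - 1 := by
  obtain ⟨hlt, hmax⟩ := lastTop_uA hω ht
  obtain ⟨h1, h2, h3⟩ := lastTM_spec ht
  have hmin : maxY n ω + 2 ≤ tailMin (n + 3) (uA n ω) := by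
    rw [tailMin, dif_pos ht']
    refine Finset.le_inf' _ _ fun i hi => ?_
    obtain ⟨hi1, hi2⟩ := Finset.mem_Ioc.1 hi
    rw [hlt] at hi1
    rw [uA_of_ge n ω (by omega), flipY_apply_one]
    have := lt_maxY_of_lastTop_lt ω (show lastTop n ω < i - 3 by omega) (by omega)
    omega
  rw [depth, depth, hmax]
  omega

/-- `lastLE`: in case A the last time at level `≤ M` is `t + 1`. [cite: MadrasSlade1993, §3.1 (proof of Proposition 3.1.5: "n_j is the largest value of i for which this maximum is attained"; recovery of ω from ω' and A₁)] -/
theorem findGreatest_le_uA : Nat.findGreatest (fun i => uA n ω i 1 ≤ maxY n ω) (n + 3) = lastTop n ω + 1 := by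
  have hP : uA n ω (lastTop n ω + 1) 1 ≤ maxY n ω := by
    rcases uA_profile hω ht (i := lastTop n ω + 1) (by omega) with ⟨ai, -⟩ | ⟨-, -, a1⟩ | ⟨ai, -⟩ | ⟨ai, -⟩ | ⟨ai, -⟩
    · omega
    · rw [a1]
    · omega
    · omega
    · omega
  apply le_antisymm
  · by_contra h
    rw [not_le] at h
    have hspec : uA n ω (Nat.findGreatest (fun i => uA n ω i 1 ≤ maxY n ω) (n + 3)) 1 ≤ maxY n ω :=
      Nat.findGreatest_spec (P := fun i => uA n ω i 1 ≤ maxY n ω) (show lastTop n ω + 1 ≤ n + 3 by omega) hP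
    have hle : Nat.findGreatest (fun i => uA n ω i 1 ≤ maxY n ω) (n + 3) ≤ n + 3 := Nat.findGreatest_le _
    rcases uA_profile hω ht hle with ⟨ai, -⟩ | ⟨ai, -⟩ | ⟨-, -, a1⟩ | ⟨-, -, a1⟩ | ⟨-, -, a1, al⟩
    · omega
    · omega
    · rw [a1] at hspec; omega
    · rw [a1] at hspec; omega
    · rw [a1] at hspec; omega
  · exact Nat.le_findGreatest (by omega) hP

end MaxA

section MaxB

variable (hω : ω ∈ hp n) (ht : lastTop n ω < n) (hq : qOf n ω 0 < 0)
include hω ht hq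

/-- **New maximum, case B**: `t(uB) = lastTM + 1` and `M(uB) = 2M + 1 − m`. [cite: MadrasSlade1993, §3.1 (proof of Proposition 3.1.5)] -/
theorem lastTop_uB : lastTop (n + 1) (uB n ω) = lastTM n ω + 1 ∧ maxY (n + 1) (uB n ω) = 2 * maxY n ω + 1 - tailMin n ω := by
  obtain ⟨h1, h2, h3⟩ := lastTM_spec ht
  have hmM := tailMin_le_maxY_sub_one ht hω
  have hval : uB n ω (lastTM n ω + 1) 1 = 2 * maxY n ω + 1 - tailMin n ω := by
    rw [uB_of_gt n ω (by omega), flipY_apply_one, Nat.add_sub_cancel, h3]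
  have key := lastTop_eq_of (n := n + 1) (ω := uB n ω) (p := lastTM n ω + 1) (by omega) ?_ ?_
  · rw [hval] at key; exact key
  · intro i hi
    rw [hval]
    rcases uB_profile hω ht hq hi with ⟨-, av, al⟩ | ⟨-, -, a1⟩ | ⟨-, -, a1⟩ | ⟨ai, -, a1, -⟩
    · rw [av]; omega
    · rw [a1]; omega
    · rw [a1]; omega
    · rw [a1]; have := tailMin_le ht (show lastTop n ω < i - 1 by omega) (by omega); omega
  · intro i hpi hi
    rw [hval, uB_of_gt n ω (by omega), flipY_apply_one]
    have := tailMin_lt_of_lastTM_lt ht (show lastTM n ω < i - 1 by omega) (by omega)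
    omega

/-- The increment of the maximum in case B is the depth. [cite: MadrasSlade1993, §3.1 (proof of Proposition 3.1.5)] -/
theorem maxY_uB : maxY (n + 1) (uB n ω) = maxY n ω + depth n ω := by
  rw [(lastTop_uB hω ht hq).2, depth]; ring

/-- **Case B shrinks the depth.** [cite: MadrasSlade1993, §3.1 (proof of Proposition 3.1.5)] -/
theorem depth_uB (ht' : lastTop (n + 1) (uB n ω) < n + 1) : depth (n + 1) (uB n ω) ≤ depth n ω - 1 := by
  obtain ⟨hlt, hmax⟩ := lastTop_uB hω ht hq
  obtain ⟨h1, h2, h3⟩ := lastTM_spec ht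
  have hmin : maxY n ω + 2 ≤ tailMin (n + 1) (uB n ω) := by
    rw [tailMin, dif_pos ht']
    refine Finset.le_inf' _ _ fun i hi => ?_
    obtain ⟨hi1, hi2⟩ := Finset.mem_Ioc.1 hi
    rw [hlt] at hi1
    rw [uB_of_gt n ω (by omega), flipY_apply_one]
    have := lt_maxY_of_lastTop_lt ω (show lastTop n ω < i - 1 by omega) (by omega)
    omega
  rw [depth, depth, hmax]
  omega

/-- `lastLE`: in case B the last time at level `≤ M` is `t − 1`. [cite: MadrasSlade1993, §3.1 (proof of Proposition 3.1.5)] -/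
theorem findGreatest_le_uB : Nat.findGreatest (fun i => uB n ω i 1 ≤ maxY n ω) (n + 1) = lastTop n ω - 1 := by
  have h2t := (boxed_case hω ht hq).2.2.1
  have hP : uB n ω (lastTop n ω - 1) 1 ≤ maxY n ω := by
    rcases uB_profile hω ht hq (i := lastTop n ω - 1) (by omega) with ⟨-, av, al⟩ | ⟨ai, -⟩ | ⟨ai, -⟩ | ⟨ai, -⟩
    · rw [av]; exact al
    · omega
    · omega
    · omega
  apply le_antisymm
  · by_contra h
    rw [not_le] at h
    have hspec : uB n ω (Nat.findGreatest (fun i => uB n ω i 1 ≤ maxY n ω) (n + 1)) 1 ≤ maxY n ω :=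
      Nat.findGreatest_spec (P := fun i => uB n ω i 1 ≤ maxY n ω) (show lastTop n ω - 1 ≤ n + 1 by omega) hP
    have hle : Nat.findGreatest (fun i => uB n ω i 1 ≤ maxY n ω) (n + 1) ≤ n + 1 := Nat.findGreatest_le _
    rcases uB_profile hω ht hq hle with ⟨ai, -⟩ | ⟨-, -, a1⟩ | ⟨-, -, a1⟩ | ⟨-, -, a1, al⟩
    · omega
    · rw [a1] at hspec; omega
    · rw [a1] at hspec; omega
    · rw [a1] at hspec; omega
  · exact Nat.le_findGreatest (by omega) hP

end MaxB


/-! ### Visits along the splices: `v(ω) ≤ v(u ω) ≤ v(ω) + 2` -/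

/-- `visits` as the cardinality of the set of visit times. [cite: Beaton2014RotatedHoneycomb, §3.1 (arXiv v3 p. 11: "occupying m vertices in the surface")] -/
theorem visits_eq_card (n : ℕ) (ω : ℕ → Site 2) : visits n ω = #((range (n + 1)).filter fun i => ω i 0 = 0) := by
  induction n with
  | zero =>
    rw [visits_zero, show range (0 + 1) = {0} from rfl, Finset.filter_singleton]
    split_ifs <;> simp
  | succ n ih =>
    rw [visits_succ, ih, show range (n + 1 + 1) = insert (n + 1) (range (n + 1)) from Finset.range_add_one,
      Finset.filter_insert]
    have hn : n + 1 ∉ (range (n + 1)).filter (fun i => ω i 0 = 0) := by simp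
    by_cases h : ω (n + 1) 0 = 0
    · rw [if_pos h, if_pos h, Finset.card_insert_of_notMem hn]
    · rw [if_neg h, if_neg h, add_zero]

/-- Comparison of visit counts along a time change `f` that preserves the wall coordinate, with at most two extra visit times.
[cite: Beaton2014RotatedHoneycomb, §3.1 (arXiv v3 p. 11: "occupying m vertices in the surface")] -/
theorem visits_le_visits_add_two {n n' : ℕ} {ω ω' : ℕ → Site 2} (f : ℕ → ℕ) (hf : ∀ i ≤ n, f i ≤ n' ∧ ω' (f i) 0 = ω i 0)
    (hinj : ∀ i ≤ n, ∀ j ≤ n, f i = f j → i = j) (e₁ e₂ : ℕ)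
    (hcov : ∀ k ≤ n', ω' k 0 = 0 → k = e₁ ∨ k = e₂ ∨ ∃ i ≤ n, f i = k) :
    visits n ω ≤ visits n' ω' ∧ visits n' ω' ≤ visits n ω + 2 := by
  classical
  rw [visits_eq_card, visits_eq_card]
  set V := (range (n + 1)).filter fun i => ω i 0 = 0
  set V' := (range (n' + 1)).filter fun i => ω' i 0 = 0
  have h1 : #V ≤ #V' := by
    refine Finset.card_le_card_of_injOn f (fun i hi => ?_) fun i hi j hj hij => ?_
    · rw [Finset.mem_coe, Finset.mem_filter, Finset.mem_range] at hi
      obtain ⟨hle, hX⟩ := hf i (by omega)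
      exact Finset.mem_filter.2 ⟨Finset.mem_range.2 (by omega), by rw [hX, hi.2]⟩
    · rw [Finset.mem_coe, Finset.mem_filter, Finset.mem_range] at hi hj
      exact hinj i (by omega) j (by omega) hij
  have h2 : V' ⊆ insert e₁ (insert e₂ (V.image f)) := by
    intro k hk
    rw [Finset.mem_filter, Finset.mem_range] at hk
    rcases hcov k (by omega) hk.2 with rfl | rfl | ⟨i, hi, rfl⟩
    · exact Finset.mem_insert_self _ _
    · exact Finset.mem_insert_of_mem (Finset.mem_insert_self _ _)
    · refine Finset.mem_insert_of_mem (Finset.mem_insert_of_mem (Finset.mem_image.2 ⟨i, ?_, rfl⟩))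
      exact Finset.mem_filter.2 ⟨Finset.mem_range.2 (by omega), by rw [← (hf i hi).2, hk.2]⟩
  refine ⟨h1, ?_⟩
  calc #V' ≤ #(insert e₁ (insert e₂ (V.image f))) := Finset.card_le_card h2
    _ ≤ #(insert e₂ (V.image f)) + 1 := Finset.card_insert_le _ _
    _ ≤ #(V.image f) + 1 + 1 := by linarith [Finset.card_insert_le e₂ (V.image f)]
    _ ≤ #V + 2 := by linarith [Finset.card_image_le (s := V) (f := f)]

/-- **Visits in case A**: `v(ω) ≤ v(uA) ≤ v(ω) + 2` (the inserted `q`, `q + e₁` may lie on the wall; `z + e₁` does not).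
[cite: Beaton2014RotatedHoneycomb, §3.1 (arXiv v3 p. 13: "the only time when we can add surface contacts …")] -/
theorem visits_uA (hω : ω ∈ hp n) (ht : lastTop n ω < n) (hq : 0 ≤ qOf n ω 0) :
    visits n ω ≤ visits (n + 3) (uA n ω) ∧ visits (n + 3) (uA n ω) ≤ visits n ω + 2 := by
  obtain ⟨h1t, ⟨ax, -, -⟩, ⟨-, px⟩⟩ := pivot_anatomy hω ht
  have hXp := (mem_hp.1 hω).2 (lastTop n ω - 1) (by omega)
  have hq0 : qOf n ω 0 = 2 * ω (lastTop n ω) 0 - ω (lastTop n ω - 1) 0 := rfl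
  have hz : ω (lastTop n ω) 0 ≠ 0 := by rw [hq0] at hq; omega
  refine visits_le_visits_add_two (fun i => if i ≤ lastTop n ω then i else i + 3) (fun i hi => ?_) (fun i hi j hj hij => ?_)
    (lastTop n ω + 1) (lastTop n ω + 2) (fun k hk hX => ?_)
  · split_ifs with h
    · exact ⟨by omega, by rw [uA_of_le n ω h]⟩
    · exact ⟨by omega, by rw [uA_of_ge n ω (by omega), flipY_apply_zero, Nat.add_sub_cancel]⟩
  · split_ifs at hij <;> omega
  · rcases uA_profile hω ht hk with ⟨ai, av, -⟩ | ⟨ai, -⟩ | ⟨ai, -⟩ | ⟨ai, a0, -⟩ | ⟨ai, a0, -⟩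
    · right; right; exact ⟨k, by omega, by rw [if_pos ai]⟩
    · exact Or.inl ai
    · exact Or.inr (Or.inl ai)
    · exfalso; rw [a0] at hX; exact hz hX
    · right; right; exact ⟨k - 3, by omega, by rw [if_neg (by omega)]; omega⟩

/-- **Visits in case B**: `v(ω) ≤ v(uB) ≤ v(ω) + 2` (in fact equal: the inserted `(1, M+1)` is off the wall). [cite: Beaton2014RotatedHoneycomb, §3.1, proof of Proposition 7 (arXiv v3 pp. 12–13)] -/
theorem visits_uB (hω : ω ∈ hp n) (ht : lastTop n ω < n) (hq : qOf n ω 0 < 0) :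
    visits n ω ≤ visits (n + 1) (uB n ω) ∧ visits (n + 1) (uB n ω) ≤ visits n ω + 2 := by
  obtain ⟨h1t, -, -⟩ := pivot_anatomy hω ht
  refine visits_le_visits_add_two (fun i => if i < lastTop n ω then i else i + 1) (fun i hi => ?_) (fun i hi j hj hij => ?_)
    (lastTop n ω) (lastTop n ω) (fun k hk hX => ?_)
  · split_ifs with h
    · exact ⟨by omega, by rw [uB_of_lt n ω h]⟩
    · exact ⟨by omega, by rw [uB_of_gt n ω (by omega), flipY_apply_zero, Nat.add_sub_cancel]⟩
  · split_ifs at hij <;> omega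
  · rcases uB_profile hω ht hq hk with ⟨ai, av, -⟩ | ⟨ai, -⟩ | ⟨ai, a0, -⟩ | ⟨ai, a0, -⟩
    · right; right; exact ⟨k, by omega, by rw [if_pos ai]⟩
    · exact Or.inl ai
    · right; right; exact ⟨k - 1, by omega, by rw [if_neg (by omega)]; omega⟩
    · right; right; exact ⟨k - 1, by omega, by rw [if_neg (by omega)]; omega⟩

/-! ### The unfolding step on states `(n, ω)` -/

/-- A state: a length and a walk. [cite: Beaton2014RotatedHoneycomb, §3.1, proof of Proposition 7 (arXiv v3 pp. 12–13: the fixed-length unfolding)] -/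
abbrev St : Type := ℕ × (ℕ → Site 2)

/-- States have (classical) decidable equality — fixed once, so that all `Finset.image`s of states use the same instance. [folklore] -/
noncomputable instance instDecidableEqSt : DecidableEq St := Classical.typeDecidableEq St

/-- Good states: `C`-class walks. [cite: Beaton2014RotatedHoneycomb, §3.1, proof of Proposition 7 (arXiv v3 pp. 12–13: the fixed-length unfolding)] -/
def Good (σ : St) : Prop := σ.2 ∈ hp σ.1

/-- **The armchair unfolding step** on states: identity on top-unfolded walks, case A or case B otherwise.
[cite: Beaton2014RotatedHoneycomb, §3.1 (arXiv v3 p. 13, steps 3–4 of the fixed-length unfolding)] -/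
def ust (σ : St) : St :=
  if lastTop σ.1 σ.2 < σ.1 then (if 0 ≤ qOf σ.1 σ.2 0 then (σ.1 + 3, uA σ.1 σ.2) else (σ.1 + 1, uB σ.1 σ.2)) else σ

/-- The step fixes top-unfolded states. [cite: Beaton2014RotatedHoneycomb, §3.1, proof of Proposition 7 (arXiv v3 pp. 12–13: the fixed-length unfolding)] -/
theorem ust_of_not_lt {σ : St} (h : ¬ lastTop σ.1 σ.2 < σ.1) : ust σ = σ := by unfold ust; rw [if_neg h]
/-- The step in case A. [cite: Beaton2014RotatedHoneycomb, §3.1, proof of Proposition 7 (arXiv v3 pp. 12–13: the fixed-length unfolding)] -/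
theorem ust_of_A {σ : St} (h : lastTop σ.1 σ.2 < σ.1) (hq : 0 ≤ qOf σ.1 σ.2 0) : ust σ = (σ.1 + 3, uA σ.1 σ.2) := by
  unfold ust; rw [if_pos h, if_pos hq]
/-- The step in case B. [cite: Beaton2014RotatedHoneycomb, §3.1, proof of Proposition 7 (arXiv v3 pp. 12–13: the fixed-length unfolding)] -/
theorem ust_of_B {σ : St} (h : lastTop σ.1 σ.2 < σ.1) (hq : ¬ 0 ≤ qOf σ.1 σ.2 0) : ust σ = (σ.1 + 1, uB σ.1 σ.2) := by
  unfold ust; rw [if_pos h, if_neg hq]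

/-- **The step, all cases at once**: goodness, length in `{n, n+1, n+3}`, endpoint abscissa, visits, strict bottom, and — when effective —
the new maximum `M + D` with `D ≥ 2`. [cite: Beaton2014RotatedHoneycomb, §3.1 (arXiv v3 pp. 12–13)] -/
theorem ust_spec {σ : St} (hσ : Good σ) :
    Good (ust σ) ∧ σ.1 ≤ (ust σ).1 ∧ (ust σ).1 ≤ σ.1 + 3 ∧ (ust σ).2 (ust σ).1 0 = σ.2 σ.1 0 ∧
      visits σ.1 σ.2 ≤ visits (ust σ).1 (ust σ).2 ∧ visits (ust σ).1 (ust σ).2 ≤ visits σ.1 σ.2 + 2 ∧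
      ((∀ i, 1 ≤ i → i ≤ σ.1 → 1 ≤ σ.2 i 1) → ∀ i, 1 ≤ i → i ≤ (ust σ).1 → 1 ≤ (ust σ).2 i 1) ∧
      (lastTop σ.1 σ.2 < σ.1 → maxY (ust σ).1 (ust σ).2 = maxY σ.1 σ.2 + depth σ.1 σ.2 ∧ 2 ≤ depth σ.1 σ.2) := by
  obtain ⟨n, ω⟩ := σ
  change ω ∈ hp n at hσ
  by_cases ht : lastTop n ω < n
  · have hD : 2 ≤ depth n ω := by have := tailMin_le_maxY_sub_one ht hσ; rw [depth]; omega
    by_cases hq : 0 ≤ qOf n ω 0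
    · rw [ust_of_A (σ := (n, ω)) ht hq]
      obtain ⟨v1, v2⟩ := visits_uA hσ ht hq
      exact ⟨uA_mem hσ ht hq, by simp, by simp, uA_end_zero ht, v1, v2, fun hb i hi1 hi => uA_bottom hσ ht hb hi1 hi,
        fun _ => ⟨maxY_uA hσ ht, hD⟩⟩
    · rw [ust_of_B (σ := (n, ω)) ht hq]
      rw [not_le] at hq
      obtain ⟨v1, v2⟩ := visits_uB hσ ht hq
      exact ⟨uB_mem hσ ht hq, by simp, by simp, uB_end_zero ht, v1, v2, fun hb i hi1 hi => uB_bottom hσ ht hq hb hi1 hi,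
        fun _ => ⟨maxY_uB hσ ht hq, hD⟩⟩
  · rw [ust_of_not_lt (σ := (n, ω)) ht]
    exact ⟨hσ, le_rfl, by simp, rfl, le_rfl, by simp, fun hb => hb, fun h => absurd h ht⟩

/-- An effective step produces a state that, if still effective, has strictly smaller depth. [cite: MadrasSlade1993, §3.1 (proof of Proposition 3.1.5: "A₁ > A₂ > ⋯")] -/
theorem depth_ust {σ : St} (hσ : Good σ) (ht : lastTop σ.1 σ.2 < σ.1) (ht' : lastTop (ust σ).1 (ust σ).2 < (ust σ).1) :
    depth (ust σ).1 (ust σ).2 ≤ depth σ.1 σ.2 - 1 := by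
  obtain ⟨n, ω⟩ := σ
  change ω ∈ hp n at hσ
  by_cases hq : 0 ≤ qOf n ω 0
  · rw [ust_of_A (σ := (n, ω)) ht hq] at ht' ⊢; exact depth_uA hσ ht ht'
  · rw [ust_of_B (σ := (n, ω)) ht hq] at ht' ⊢; rw [not_le] at hq; exact depth_uB hσ ht hq ht'

/-- An effective step raises the maximum strictly. [cite: MadrasSlade1993, §3.1 (proof of Proposition 3.1.5: A₁(ω), n₁(ω), the unfolded walk ω')] -/
theorem maxY_lt_maxY_ust {σ : St} (hσ : Good σ) (ht : lastTop σ.1 σ.2 < σ.1) : maxY σ.1 σ.2 < maxY (ust σ).1 (ust σ).2 := by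
  obtain ⟨h1, h2⟩ := (ust_spec hσ).2.2.2.2.2.2.2 ht
  omega

/-- **The step is injective given the old maximum** (on good states): decode by the last time at level `≤ M` and the column test.
[cite: MadrasSlade1993, §3.1 (proof of Proposition 3.1.5: ω is recovered from ω' and A₁(ω)); Beaton2014RotatedHoneycomb, §3.1 (arXiv v3 p. 12: "the number of SAWs which result in the same unfolded walk")] -/
theorem ust_injOn_level {σ₁ σ₂ : St} (h₁ : Good σ₁) (h₂ : Good σ₂) (hM : maxY σ₁.1 σ₁.2 = maxY σ₂.1 σ₂.2) (he : ust σ₁ = ust σ₂) :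
    σ₁ = σ₂ := by
  obtain ⟨n₁, ω₁⟩ := σ₁
  obtain ⟨n₂, ω₂⟩ := σ₂
  change ω₁ ∈ hp n₁ at h₁
  change ω₂ ∈ hp n₂ at h₂
  change maxY n₁ ω₁ = maxY n₂ ω₂ at hM
  by_cases ht₁ : lastTop n₁ ω₁ < n₁ <;> by_cases ht₂ : lastTop n₂ ω₂ < n₂
  · -- both effective
    obtain ⟨f₁, hfr₁, -, -⟩ := mem_saws_iff.1 (mem_hp.1 h₁).1
    obtain ⟨f₂, hfr₂, -, -⟩ := mem_saws_iff.1 (mem_hp.1 h₂).1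
    by_cases hq₁ : 0 ≤ qOf n₁ ω₁ 0 <;> by_cases hq₂ : 0 ≤ qOf n₂ ω₂ 0
    · -- A / A
      rw [ust_of_A (σ := (n₁, ω₁)) ht₁ hq₁, ust_of_A (σ := (n₂, ω₂)) ht₂ hq₂] at he
      simp only [Prod.mk.injEq] at he
      obtain ⟨hn, hω⟩ := he
      have hn' : n₁ = n₂ := by omega
      subst hn'
      have hl₁ := findGreatest_le_uA h₁ ht₁
      have hl₂ := findGreatest_le_uA h₂ ht₂
      rw [hω, hM] at hl₁
      rw [hl₁] at hl₂
      have htt : lastTop n₁ ω₁ = lastTop n₁ ω₂ := by omega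
      refine Prod.ext rfl (funext fun i => ?_)
      change ω₁ i = ω₂ i
      rcases le_or_gt i (lastTop n₁ ω₁) with hi | hi
      · rw [← uA_of_le n₁ ω₁ hi, hω, uA_of_le n₁ ω₂ (by omega)]
      · rcases le_or_gt i n₁ with hin | hin
        · have e := congrFun hω (i + 3)
          rw [uA_of_ge n₁ ω₁ (by omega), uA_of_ge n₁ ω₂ (by omega), Nat.add_sub_cancel, hM] at e
          exact flipY_injective _ e
        · have e := congrFun hω (n₁ + 3)
          rw [uA_of_ge n₁ ω₁ (by omega), uA_of_ge n₁ ω₂ (by omega), show n₁ + 3 - 3 = n₁ by omega, hM] at e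
          rw [hfr₁ i hin.le, hfr₂ i hin.le]; exact flipY_injective _ e
    · -- A / B: lengths `n₁ + 3 = n₂ + 1`, then the column test
      exfalso
      rw [ust_of_A (σ := (n₁, ω₁)) ht₁ hq₁, ust_of_B (σ := (n₂, ω₂)) ht₂ hq₂] at he
      simp only [Prod.mk.injEq] at he
      obtain ⟨hn, hω⟩ := he
      rw [not_le] at hq₂
      have hl₁ := findGreatest_le_uA h₁ ht₁
      have hl₂ := findGreatest_le_uB h₂ ht₂ hq₂
      rw [hω, hM, hn] at hl₁
      rw [hl₁] at hl₂
      obtain ⟨hz0, hp0, h2t, hpp0, -⟩ := boxed_case h₂ ht₂ hq₂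
      obtain ⟨h1t₁, ⟨ax₁, -⟩, -⟩ := pivot_anatomy h₁ ht₁
      -- column test: in A, `uA (t₁+3) 0 = uA t₁ 0`; in B at the same times (`t₂+1`, `t₂-2`): `0` and `2`
      have eA : uA n₁ ω₁ (lastTop n₁ ω₁ + 3) 0 = uA n₁ ω₁ (lastTop n₁ ω₁) 0 := by
        rw [uA_t3, shiftY_apply_zero, uA_of_le n₁ ω₁ le_rfl]
      rw [hω, show lastTop n₁ ω₁ + 3 = lastTop n₂ ω₂ + 1 by omega, show lastTop n₁ ω₁ = lastTop n₂ ω₂ - 2 by omega,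
        uB_of_gt n₂ ω₂ (by omega), flipY_apply_zero, Nat.add_sub_cancel, hz0, uB_of_lt n₂ ω₂ (by omega), hpp0] at eA
      exact absurd eA (by norm_num)
    · -- B / A (symmetric)
      exfalso
      rw [ust_of_B (σ := (n₁, ω₁)) ht₁ hq₁, ust_of_A (σ := (n₂, ω₂)) ht₂ hq₂] at he
      simp only [Prod.mk.injEq] at he
      obtain ⟨hn, hω⟩ := he
      rw [not_le] at hq₁
      have hl₁ := findGreatest_le_uB h₁ ht₁ hq₁
      have hl₂ := findGreatest_le_uA h₂ ht₂
      rw [hω, hM, hn] at hl₁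
      rw [hl₁] at hl₂
      obtain ⟨hz0, hp0, h2t, hpp0, -⟩ := boxed_case h₁ ht₁ hq₁
      obtain ⟨h1t₂, ⟨ax₂, -⟩, -⟩ := pivot_anatomy h₂ ht₂
      have eA : uA n₂ ω₂ (lastTop n₂ ω₂ + 3) 0 = uA n₂ ω₂ (lastTop n₂ ω₂) 0 := by
        rw [uA_t3, shiftY_apply_zero, uA_of_le n₂ ω₂ le_rfl]
      rw [← hω, show lastTop n₂ ω₂ + 3 = lastTop n₁ ω₁ + 1 by omega, show lastTop n₂ ω₂ = lastTop n₁ ω₁ - 2 by omega,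
        uB_of_gt n₁ ω₁ (by omega), flipY_apply_zero, Nat.add_sub_cancel, hz0, uB_of_lt n₁ ω₁ (by omega), hpp0] at eA
      exact absurd eA (by norm_num)
    · -- B / B
      rw [ust_of_B (σ := (n₁, ω₁)) ht₁ hq₁, ust_of_B (σ := (n₂, ω₂)) ht₂ hq₂] at he
      simp only [Prod.mk.injEq] at he
      obtain ⟨hn, hω⟩ := he
      rw [not_le] at hq₁ hq₂
      have hn' : n₁ = n₂ := by omega
      subst hn'
      have hl₁ := findGreatest_le_uB h₁ ht₁ hq₁
      have hl₂ := findGreatest_le_uB h₂ ht₂ hq₂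
      rw [hω, hM] at hl₁
      rw [hl₁] at hl₂
      have h2t := (boxed_case h₁ ht₁ hq₁).2.2.1
      have htt : lastTop n₁ ω₁ = lastTop n₁ ω₂ := by omega
      refine Prod.ext rfl (funext fun i => ?_)
      change ω₁ i = ω₂ i
      rcases Nat.lt_or_ge i (lastTop n₁ ω₁) with hi | hi
      · rw [← uB_of_lt n₁ ω₁ hi, hω, uB_of_lt n₁ ω₂ (by omega)]
      · rcases le_or_gt i n₁ with hin | hin
        · have e := congrFun hω (i + 1)
          rw [uB_of_gt n₁ ω₁ (by omega), uB_of_gt n₁ ω₂ (by omega), Nat.add_sub_cancel, hM] at e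
          exact flipY_injective _ e
        · have e := congrFun hω (n₁ + 1)
          rw [uB_of_gt n₁ ω₁ (by omega), uB_of_gt n₁ ω₂ (by omega), Nat.add_sub_cancel, hM] at e
          rw [hfr₁ i hin.le, hfr₂ i hin.le]; exact flipY_injective _ e
  · -- effective / ineffective: the maxima differ
    exfalso
    have h := maxY_lt_maxY_ust (σ := (n₁, ω₁)) h₁ ht₁
    rw [he, ust_of_not_lt (σ := (n₂, ω₂)) ht₂] at h
    change maxY n₁ ω₁ < maxY n₂ ω₂ at h
    omega
  · exfalso
    have h := maxY_lt_maxY_ust (σ := (n₂, ω₂)) h₂ ht₂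
    rw [← he, ust_of_not_lt (σ := (n₁, ω₁)) ht₁] at h
    change maxY n₂ ω₂ < maxY n₁ ω₁ at h
    omega
  · rw [ust_of_not_lt (σ := (n₁, ω₁)) ht₁, ust_of_not_lt (σ := (n₂, ω₂)) ht₂] at he; exact he


/-! ### Iterating the step: invariants and termination after `O(√n)` steps -/

/-- **Invariants of the iterated step**: goodness, length growth `≤ 3k`, endpoint abscissa, visits `v ≤ v_k ≤ v + 2k`, strict bottom.
[cite: Beaton2014RotatedHoneycomb, §3.1 (arXiv v3 p. 13: "the process takes a walk of length n and maps it to an unfolded walk of length n + ⌊3√n⌋ + i")] -/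
theorem iterate_spec {σ : St} (hσ : Good σ) (k : ℕ) :
    Good (ust^[k] σ) ∧ σ.1 ≤ (ust^[k] σ).1 ∧ (ust^[k] σ).1 ≤ σ.1 + 3 * k ∧ (ust^[k] σ).2 (ust^[k] σ).1 0 = σ.2 σ.1 0 ∧
      visits σ.1 σ.2 ≤ visits (ust^[k] σ).1 (ust^[k] σ).2 ∧ visits (ust^[k] σ).1 (ust^[k] σ).2 ≤ visits σ.1 σ.2 + 2 * k ∧
      ((∀ i, 1 ≤ i → i ≤ σ.1 → 1 ≤ σ.2 i 1) → ∀ i, 1 ≤ i → i ≤ (ust^[k] σ).1 → 1 ≤ (ust^[k] σ).2 i 1) := by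
  induction k with
  | zero =>
    simp only [Function.iterate_zero, id_eq, Nat.mul_zero, add_zero]
    exact ⟨hσ, le_rfl, le_rfl, trivial, le_rfl, le_rfl, id⟩
  | succ k ih =>
    obtain ⟨hg, hl1, hl2, hend, hv1, hv2, hbot⟩ := ih
    obtain ⟨hg', hl1', hl2', hend', hv1', hv2', hbot', -⟩ := ust_spec hg
    rw [Function.iterate_succ_apply']
    refine ⟨hg', hl1.trans hl1', by omega, by rw [hend', hend], hv1.trans hv1', by omega, fun hb => hbot' (hbot hb)⟩

/-- Once top-unfolded, the iteration is constant. [cite: Beaton2014RotatedHoneycomb, §3.1, proof of Proposition 7 (arXiv v3 pp. 12–13: the fixed-length unfolding)] -/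
theorem iterate_of_not_lt {σ : St} (h : ¬ lastTop σ.1 σ.2 < σ.1) (k : ℕ) : ust^[k] σ = σ := by
  induction k with
  | zero => rfl
  | succ k ih => rw [Function.iterate_succ_apply', ih, ust_of_not_lt h]

/-- If the `K`-th iterate is still effective, so are all the earlier ones. [cite: Beaton2014RotatedHoneycomb, §3.1, proof of Proposition 7 (arXiv v3 pp. 12–13: the fixed-length unfolding)] -/
theorem lt_of_iterate_lt {σ : St} {K : ℕ} (hK : lastTop (ust^[K] σ).1 (ust^[K] σ).2 < (ust^[K] σ).1) {j : ℕ} (hj : j ≤ K) :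
    lastTop (ust^[j] σ).1 (ust^[j] σ).2 < (ust^[j] σ).1 := by
  by_contra h
  have : ust^[K] σ = ust^[j] σ := by
    rw [show K = (K - j) + j by omega, Function.iterate_add_apply]; exact iterate_of_not_lt h _
  rw [this] at hK
  exact h hK

/-- **Termination**: if `K (K − 1) > 2n` then the `K`-th iterate of a good state of length `n` is top-unfolded (the depths along an
effective run are `≥ 2` and strictly decreasing, and their sum — the total rise of the maximum — is at most the final length `≤ n + 3K`).
[cite: MadrasSlade1993, §3.1 (proof of Proposition 3.1.5: "A₁ > A₂ > … > A_k"; the √-count of distinct parts is Beaton's ⌊(−1+√(1+8n))/2⌋, arXiv v3 p. 12); Beaton2014RotatedHoneycomb, §3.1 (arXiv v3 p. 13: "we never have to perform the unfolding operation more than ⌊3√n⌋ times")] -/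
theorem not_lt_iterate {σ : St} (hσ : Good σ) {K : ℕ} (hK : 2 * σ.1 < K * (K - 1)) :
    ¬ lastTop (ust^[K] σ).1 (ust^[K] σ).2 < (ust^[K] σ).1 := by
  intro hlt
  have heff : ∀ j ≤ K, lastTop (ust^[j] σ).1 (ust^[j] σ).2 < (ust^[j] σ).1 := fun j hj => lt_of_iterate_lt hlt hj
  have hgood : ∀ j, Good (ust^[j] σ) := fun j => (iterate_spec hσ j).1
  -- depths: `D_K ≥ 2`, `D_j ≥ D_{j+1} + 1`
  have hdepth : ∀ r, r ≤ K → (2 : ℤ) + r ≤ depth (ust^[K - r] σ).1 (ust^[K - r] σ).2 := by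
    intro r
    induction r with
    | zero => intro _; rw [Nat.sub_zero]; exact ((ust_spec (hgood K)).2.2.2.2.2.2.2 (heff K le_rfl)).2
    | succ r ih =>
      intro hr
      have h1 := ih (by omega)
      have h2 := depth_ust (hgood (K - (r + 1))) (heff _ (by omega)) (by
        rw [← Function.iterate_succ_apply' ust, show (K - (r + 1)).succ = K - r by omega]; exact heff _ (by omega))
      rw [← Function.iterate_succ_apply' ust, show (K - (r + 1)).succ = K - r by omega] at h2
      push_cast
      linarith
  -- maxima: `M_{j+1} = M_j + D_j`, hence `2 (M_K − M_{K−r}) ≥ r (r + 5)`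
  have hsum : ∀ r, r ≤ K → (r : ℤ) * (r + 5) ≤ 2 * (maxY (ust^[K] σ).1 (ust^[K] σ).2 - maxY (ust^[K - r] σ).1 (ust^[K - r] σ).2) := by
    intro r
    induction r with
    | zero => intro _; simp
    | succ r ih =>
      intro hr
      have h1 := ih (by omega)
      have hD := hdepth (r + 1) hr
      have hstep := ((ust_spec (hgood (K - (r + 1)))).2.2.2.2.2.2.2 (heff _ (by omega))).1
      rw [← Function.iterate_succ_apply' ust, show (K - (r + 1)).succ = K - r by omega] at hstep
      rw [hstep] at h1
      push_cast at hD h1 ⊢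
      nlinarith
  have hK0 := hsum K le_rfl
  rw [Nat.sub_self, Function.iterate_zero, id_eq] at hK0
  have hM0 := (maxY_bounds (mem_hp.1 hσ).1).1
  obtain ⟨-, -, hlen, -⟩ := iterate_spec hσ K
  have hMK := (maxY_bounds (mem_hp.1 (hgood K)).1).2
  have hlen' : (((ust^[K] σ).1 : ℕ) : ℤ) ≤ (σ.1 : ℤ) + 3 * K := by exact_mod_cast hlen
  have h2 : (K : ℤ) * K - K ≤ 2 * σ.1 := by nlinarith
  rcases Nat.eq_zero_or_pos K with rfl | hKpos
  · simp at hK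
  · have e : (((K * (K - 1) : ℕ)) : ℤ) = (K : ℤ) * K - K := by
      rw [Nat.cast_mul, Nat.cast_sub (by omega : 1 ≤ K)]; push_cast; ring
    have hK' : ((2 * σ.1 : ℕ) : ℤ) < ((K * (K - 1) : ℕ) : ℤ) := by exact_mod_cast hK
    rw [e] at hK'
    push_cast at hK'
    linarith

end Literature.Probability.RandomPlanarGeometry.SAW.HexBW.Arm
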